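import Summits.Ventures.HodgeRepro.QuadFinset
import Summits.Ventures.HodgeRepro.QuadRows12
import Summits.Ventures.HodgeRepro.QuadRows8
import Summits.Ventures.HodgeRepro.SingleClass

/-!
# No single-class `SumTwo` quadruple without a conjugate pair — every `(G, c)` of degrees 6, 8, 12

Blind re-derivation cell `pub-hodge-repro`, seat `typer` (gen 5).  The `Finset` form of the engine
rows (`QuadRows12.lean`, `QuadRows8.lean`) through the transfer `QuadFinset.exists_conj_of_sumTwo`,
in the vocabulary of `SingleClass.lean`: for every CM type `Φ` of `(G, c)` and every quadruple
`T : Fin 4 → Finset G` with `T 0 = Φ` which is `SumTwo` and has NO conjugate pair (`T j ≠ c • T i`),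
`T` is NOT single-class (`¬ IsSingleClass T`: not all corners are right translates of `T 0`).

In degree 12 this covers the `SumTwo` quadruples of ALL pairing patterns — the census faces
(`(4,1,1)`, already `SingleClass12*.lean`) and the non-face patterns `(3,2,1)`, `(2,2,2)` of
ROUTE.md §3.4 («no face of any pattern is single-class», previously Python-only).  In degrees 6 and 8
every such quadruple is a face (`FaceCriterion.lean`), so those rows only re-derive `SingleClass.lean`.
-/

set_option autoImplicit false

open Finset
open scoped Pointwise

namespace HodgeRepro

namespace QuadEngine

variable {G : Type*} [Group G] [DecidableEq G] [Fintype G] {n : ℕ}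

/-- **Generic form.**  If the engine check passes on `tableOf e c`, a `SumTwo` quadruple of CM
types without a conjugate pair is not single-class. -/
theorem not_isSingleClass_of_check (e : G ≃ Fin n) {c : G} (hc : IsComplexConj c)
    (hΓ : noSingleClassSumTwo (tableOf e c) = true) (T : Fin 4 → Finset G)
    (hT : IsCMType c (T 0)) (hs : SumTwo T) (hnc : ∀ i j : Fin 4, T j ≠ c • T i) :
    ¬ IsSingleClass T := by
  intro hsc
  obtain ⟨g₁, h1⟩ := hsc 1
  obtain ⟨g₂, h2⟩ := hsc 2
  obtain ⟨g₃, h3⟩ := hsc 3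
  have hT' : T = transQuad (T 0) g₁ g₂ g₃ := by
    funext i
    fin_cases i
    · rfl
    · exact h1
    · exact h2
    · exact h3
  rw [hT'] at hs
  obtain ⟨i, j, hij⟩ := exists_conj_of_sumTwo e hc hΓ hT g₁ g₂ g₃ hs
  exact hnc i j (by rw [hT']; exact hij)

/-! ### Degree 12 -/

/-- `C₁₂`: no `SumTwo` quadruple without a conjugate pair is single-class. -/
theorem not_isSingleClass_C12 (T : Fin 4 → Finset C12) (hT : IsCMType cc_C12 (T 0)) (hs : SumTwo T)
    (hnc : ∀ i j : Fin 4, T j ≠ cc_C12 • T i) : ¬ IsSingleClass T :=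
  not_isSingleClass_of_check encC12 cc_C12_isComplexConj noSingleClassSumTwo_C12 T hT hs hnc

/-- `C₆ × C₂`, each of its three involutions: no `SumTwo` quadruple without a conjugate pair is
single-class. -/
theorem not_isSingleClass_C6xC2 (c : C6xC2) (hc : c ∈ complexConjs C6xC2) (T : Fin 4 → Finset C6xC2)
    (hT : IsCMType c (T 0)) (hs : SumTwo T) (hnc : ∀ i j : Fin 4, T j ≠ c • T i) :
    ¬ IsSingleClass T := by
  have hc' : IsComplexConj c := mem_complexConjs.1 hc
  rw [complexConjs_C6xC2, Finset.mem_insert, Finset.mem_insert, Finset.mem_singleton] at hc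
  rcases hc with rfl | rfl | rfl
  · exact not_isSingleClass_of_check encC6xC2 hc' noSingleClassSumTwo_C6xC2 T hT hs hnc
  · exact not_isSingleClass_of_check encC6xC2 hc' noSingleClassSumTwo_C6xC2' T hT hs hnc
  · exact not_isSingleClass_of_check encC6xC2 hc' noSingleClassSumTwo_C6xC2'' T hT hs hnc

/-- `D₆`: no `SumTwo` quadruple without a conjugate pair is single-class. -/
theorem not_isSingleClass_D6 (T : Fin 4 → Finset D6) (hT : IsCMType cc_D6 (T 0)) (hs : SumTwo T)
    (hnc : ∀ i j : Fin 4, T j ≠ cc_D6 • T i) : ¬ IsSingleClass T :=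
  not_isSingleClass_of_check encD6 cc_D6_isComplexConj noSingleClassSumTwo_D6 T hT hs hnc

/-- `Dic₃`: no `SumTwo` quadruple without a conjugate pair is single-class. -/
theorem not_isSingleClass_Dic3 (T : Fin 4 → Finset Dic3) (hT : IsCMType cc_Dic3 (T 0))
    (hs : SumTwo T) (hnc : ∀ i j : Fin 4, T j ≠ cc_Dic3 • T i) : ¬ IsSingleClass T :=
  not_isSingleClass_of_check encDic3 cc_Dic3_isComplexConj noSingleClassSumTwo_Dic3 T hT hs hnc

/-! ### Degrees 6 and 8 (re-derivation of `SingleClass.lean`, all patterns) -/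

/-- `C₆`. -/
theorem not_isSingleClass_C6 (T : Fin 4 → Finset C6) (hT : IsCMType cc_C6 (T 0)) (hs : SumTwo T)
    (hnc : ∀ i j : Fin 4, T j ≠ cc_C6 • T i) : ¬ IsSingleClass T :=
  not_isSingleClass_of_check encC6 cc_C6_isComplexConj noSingleClassSumTwo_C6 T hT hs hnc

/-- `C₈`. -/
theorem not_isSingleClass_C8 (T : Fin 4 → Finset C8) (hT : IsCMType cc_C8 (T 0)) (hs : SumTwo T)
    (hnc : ∀ i j : Fin 4, T j ≠ cc_C8 • T i) : ¬ IsSingleClass T :=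
  not_isSingleClass_of_check encC8 cc_C8_isComplexConj noSingleClassSumTwo_C8 T hT hs hnc

/-- `C₄ × C₂`, each of its three central involutions. -/
theorem not_isSingleClass_C4xC2 (c : C4xC2) (hc : c ∈ complexConjs C4xC2) (T : Fin 4 → Finset C4xC2)
    (hT : IsCMType c (T 0)) (hs : SumTwo T) (hnc : ∀ i j : Fin 4, T j ≠ c • T i) :
    ¬ IsSingleClass T := by
  have hc' : IsComplexConj c := mem_complexConjs.1 hc
  rw [complexConjs_C4xC2, Finset.mem_insert, Finset.mem_insert, Finset.mem_singleton] at hc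
  rcases hc with rfl | rfl | rfl
  · exact not_isSingleClass_of_check encC4xC2 hc' noSingleClassSumTwo_C4xC2 T hT hs hnc
  · exact not_isSingleClass_of_check encC4xC2 hc' noSingleClassSumTwo_C4xC2' T hT hs hnc
  · exact not_isSingleClass_of_check encC4xC2 hc' noSingleClassSumTwo_C4xC2'' T hT hs hnc

/-- `C₂³`, each of its seven involutions. -/
theorem not_isSingleClass_C2xC2xC2 (c : C2xC2xC2) (hc : c ∈ complexConjs C2xC2xC2)
    (T : Fin 4 → Finset C2xC2xC2) (hT : IsCMType c (T 0)) (hs : SumTwo T)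
    (hnc : ∀ i j : Fin 4, T j ≠ c • T i) : ¬ IsSingleClass T := by
  have hc' : IsComplexConj c := mem_complexConjs.1 hc
  exact not_isSingleClass_of_check encC2xC2xC2 hc' (noSingleClassSumTwo_C2xC2xC2 c hc'.ne_one) T hT
    hs hnc

/-- `D₄`. -/
theorem not_isSingleClass_D4 (T : Fin 4 → Finset D4) (hT : IsCMType cc_D4 (T 0)) (hs : SumTwo T)
    (hnc : ∀ i j : Fin 4, T j ≠ cc_D4 • T i) : ¬ IsSingleClass T :=
  not_isSingleClass_of_check encD4 cc_D4_isComplexConj noSingleClassSumTwo_D4 T hT hs hnc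

/-- `Q₈`. -/
theorem not_isSingleClass_Q8 (T : Fin 4 → Finset Q8) (hT : IsCMType cc_Q8 (T 0)) (hs : SumTwo T)
    (hnc : ∀ i j : Fin 4, T j ≠ cc_Q8 • T i) : ¬ IsSingleClass T :=
  not_isSingleClass_of_check encQ8 cc_Q8_isComplexConj noSingleClassSumTwo_Q8 T hT hs hnc

end QuadEngine

end HodgeRepro
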